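import Summits.NavierStokesRegularity.NavierStokesRegularity.Theorems.ArgmaxDoorsSupNorm
import Summits.NavierStokesRegularity.NavierStokesRegularity.Theorems.ArgmaxDoorsFrame
import Literature.Analysis.FluidPDE.VorticityDirectionDynamics
import Literature.Analysis.FluidPDE.DriftHeatLocalComparison
import HarnessLib

/-!
# ArgmaxDoorsGrowth — door family S35 «ArgmaxDoors», plate E1 «ArgmaxGrowth» and the slab compositions

The max-norm of the vorticity read at ONE POINT PER TIME (a global argmax `x̄(t)` of `|ω(t,·)|`), with the
TWIST CREDIT `−ν|∇ξ(x̄,t)|²_F` of the magnitude equation (GGH97 (Dw1)+(Dw4); tree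
`VorticityDirectionDynamics.laplacian_norm_eq`):

* `inner_vorticity_rhs_le_at_argmax` (E1, fixed time) — at a non-zero global maximum `x̄` of
  `|curl v|`, for any `w` satisfying the vorticity equation at `x̄`:
  `⟪ω(x̄), w⟫ ≤ (α(x̄) − ν|∇ξ(x̄)|²_F)|ω(x̄)|²`, `α = ⟪ξ, ∇v ξ⟫`, `ξ = ω/|ω|`;
* `norm_curl_le_mul_exp_of_argmax_rate_le` — E1 + E2 (rate form) in the frame on `[0,T''] × ℝ³`:
  `α − ν|∇ξ|²_F ≤ φ = Φ'` at every non-zero global argmax ⇒ `sup|ω(t)| ≤ sup|ω(0)|·e^{Φ(t)−Φ(0)}`;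
* `norm_curl_le_supersolution_of_argmax_rate_le` — E1 + E2 (threshold form):
  `α − ν|∇ξ|²_F ≤ φ` at argmaxima with `|ω| > B(t)`, `B' ≥ φB` ⇒ (`|ω(0)| ≤ B(0)` → `|ω(t)| ≤ B(t)`).

HONEST FRAME / WHAT THIS IS NOT: tools for regularity CRITERIA about hypothetical blow-up (door family S35
«ArgmaxDoors», nsreg-p1 g29 ROUND-33, S-door lane LEAD ns-s30-p1 g3, `--supports stmt-NavierStokesRegularity-0056 --as helper`);
item 0056 `NoTypeII` and NS regularity are NOT proved; no Literature fact is taken as a hypothesis; nothing here is a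
route or a summit statement.
[cite: GalantiGibbonHeritage1997, §3 (Dw1), (Dw4) (arXiv:chao-dyn/9709003 p. 7); Friedman1964, Ch. 2 §4 Lemma 5]
-/

noncomputable section

set_option linter.dupNamespace false

open MeasureTheory Set Function Filter Metric Real InnerProductSpace
open _root_.Topology
open scoped ENNReal NNReal RealInnerProductSpace ContDiff Laplacian
open Literature.Analysis Literature.Analysis.FluidPDE
open Literature.Analysis.FluidPDE.VorticityDirectionDynamics

namespace Summit.NavierStokesRegularity.NavierStokesRegularity.Theorems.ArgmaxDoors

section Engine

-- nested operator types (second and third derivatives)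
set_option maxSynthPendingDepth 3

/-- **E1 «ArgmaxGrowth», pointwise at a fixed time.** Let `v ∈ C^∞(ℝ³; ℝ³)`, `ω = curl v`, let `x̄`
be a global maximum point of `|ω|` with `ω(x̄) ≠ 0`, `ν ≥ 0`, and let `w` satisfy the vorticity
equation at `x̄`: `w + (v·∇)ω(x̄) = (ω·∇)v(x̄) + νΔω(x̄)`. Then, with `ξ = ω/|ω|` and the stretching
rate `α(x̄) = ⟪ξ(x̄), ∇v(x̄) ξ(x̄)⟫`:
`⟪ω(x̄), w⟫ ≤ (α(x̄) − ν|∇ξ(x̄)|²_F)·|ω(x̄)|²`.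
Proof: `⟪ω,(ω·∇)v⟫ = α|ω|²` (`stretching_eq_norm_smul`); `⟪ω,(v·∇)ω⟫ = ½D|ω|²[v] = 0` at the
maximum (`inner_fderiv_eq_zero_of_forall_norm_sq_le`); `⟪ω,Δω⟫ = |ω|⟪ξ,Δω⟫ = |ω|(Δ|ω| − |ω||∇ξ|²_F)`
(GGH97 (Dw4), `laplacian_norm_eq`) with `Δ|ω|(x̄) ≤ 0` (`|ω|` is `C²` on the open set `{ω ≠ 0}`,
`laplacian_nonpos_of_isLocalMax_of_contDiffOn`). [cite: GalantiGibbonHeritage1997, §3 (Dw1), (Dw4)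
(arXiv:chao-dyn/9709003 p. 7); folklore (parabolic maximum principle at the argmax)] -/
theorem inner_vorticity_rhs_le_at_argmax {ν : ℝ} (hν : 0 ≤ ν)
    {v : (EuclideanSpace ℝ (Fin 3)) → (EuclideanSpace ℝ (Fin 3))} (hv : ContDiff ℝ ∞ v)
    {x₀ : EuclideanSpace ℝ (Fin 3)} (hmax : ∀ x, ‖curl v x‖ ≤ ‖curl v x₀‖) (hne : curl v x₀ ≠ 0)
    {w : EuclideanSpace ℝ (Fin 3)}
    (hw : w + convect v (curl v) x₀ = convect (curl v) v x₀ + ν • (Δ (curl v)) x₀) :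
    ⟪curl v x₀, w⟫ ≤
      (⟪vorticityDirection (curl v) x₀, fderiv ℝ v x₀ (vorticityDirection (curl v) x₀)⟫ -
          ν * frobeniusNormSq (fderiv ℝ (vorticityDirection (curl v)) x₀)) * ‖curl v x₀‖ ^ 2 := by
  set om : (EuclideanSpace ℝ (Fin 3)) → (EuclideanSpace ℝ (Fin 3)) := curl v with homdef
  have hom : ContDiff ℝ ∞ om :=
    contDiff_curl (n := ⊤) (hv.of_le (by exact_mod_cast (le_top : (⊤ + 1 : ℕ∞) ≤ ⊤)))
  have homC2 : ContDiff ℝ 2 om := contDiff_infty.mp hom 2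
  have hom2 : ContDiffAt ℝ 2 om x₀ := homC2.contDiffAt
  set ρ : ℝ := ‖om x₀‖ with hρdef
  have hρ : 0 < ρ := norm_pos_iff.2 hne
  set ξ := vorticityDirection om x₀ with hξdef
  -- the equation solved for `w`
  have heq : w = convect om v x₀ + ν • (Δ om) x₀ - convect v om x₀ := eq_sub_of_add_eq hw
  -- (a) stretching: `⟪om, ∇v om⟫ = α ρ²`
  have ha : ⟪om x₀, convect om v x₀⟫ = ⟪ξ, fderiv ℝ v x₀ ξ⟫ * ρ ^ 2 := by
    rw [convect_apply]
    have h1 : om x₀ = ρ • ξ := by rw [hξdef, hρdef, norm_smul_vorticityDirection]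
    conv_lhs => rw [h1]
    rw [map_smul, inner_smul_left, inner_smul_right]
    simp only [conj_trivial]
    ring
  -- (b) transport: `⟪om, ∇om v⟫ = 0` at the maximum
  have hmax2 : ∀ x, ‖om x‖ ^ 2 ≤ ‖om x₀‖ ^ 2 := fun x =>
    pow_le_pow_left₀ (norm_nonneg _) (hmax x) 2
  have hb : ⟪om x₀, convect v om x₀⟫ = 0 := by
    rw [convect_apply]
    exact inner_fderiv_eq_zero_of_forall_norm_sq_le hom hmax2 _
  -- (c) diffusion: `⟪om, Δom⟫ = ρ (Δ|om| − ρ |∇ξ|²_F)` and `Δ|om|(x₀) ≤ 0`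
  have hlapnorm : (Δ fun y => ‖om y‖) x₀ ≤ 0 := by
    have hopen : IsOpen {y : EuclideanSpace ℝ (Fin 3) | om y ≠ 0} :=
      isOpen_ne_fun hom.continuous continuous_const
    have hC2 : ContDiffOn ℝ 2 (fun y => ‖om y‖) {y | om y ≠ 0} := fun y hy =>
      ((homC2.contDiffAt).norm ℝ hy).contDiffWithinAt
    have hloc : IsLocalMax (fun y => ‖om y‖) x₀ := Filter.Eventually.of_forall hmax
    exact laplacian_nonpos_of_isLocalMax_of_contDiffOn hopen hne hC2 hloc
  have hc : ⟪om x₀, (Δ om) x₀⟫ ≤ -(ρ ^ 2 * frobeniusNormSq (fderiv ℝ (vorticityDirection om) x₀)) := by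
    have h1 : om x₀ = ρ • ξ := by rw [hξdef, hρdef, norm_smul_vorticityDirection]
    have h2 : ⟪ξ, (Δ om) x₀⟫ = (Δ fun y => ‖om y‖) x₀ -
        ρ * frobeniusNormSq (fderiv ℝ (vorticityDirection om) x₀) := by
      have h := laplacian_norm_eq hom2 hne
      rw [hξdef, hρdef]; linarith
    rw [h1, inner_smul_left]
    simp only [conj_trivial]
    rw [h2]
    have hF : 0 ≤ frobeniusNormSq (fderiv ℝ (vorticityDirection om) x₀) := frobeniusNormSq_nonneg _
    nlinarith [hlapnorm, hρ, hF]
  -- assemble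
  rw [heq, inner_sub_right, inner_add_right, inner_smul_right, ha, hb, sub_zero]
  have hνc : ν * ⟪om x₀, (Δ om) x₀⟫ ≤
      -(ν * frobeniusNormSq (fderiv ℝ (vorticityDirection om) x₀) * ρ ^ 2) := by
    have := mul_le_mul_of_nonneg_left hc hν
    linarith
  rw [hρdef] at hνc ⊢
  linarith

/-- **E1 + E2 on a closed slab (the argmax engine of S35).** In the S-door frame on `[0,T''] × ℝ³`
(`ν > 0`, classical unforced Navier–Stokes solution, all `L²` Sobolev seminorms bounded): if `Φ` is
continuous on `[0,T'']` with one-sided derivative `φ` and, at every `t ∈ (0,T'']` and every non-zero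
global maximum point `x̄` of `|om(t,·)|`, the twist-credited net rate obeys
`α(t,x̄) − ν|∇ξ(t,x̄)|²_F ≤ φ(t)`, then `‖om(t,·)‖_∞ ≤ ‖om(0,·)‖_∞ · e^{Φ(t) − Φ(0)}`:
`(∀ x, |om(0,x)| ≤ M) → |om(t,x)| ≤ M e^{Φ(t)−Φ(0)}` on the slab. [folklore] -/
theorem norm_curl_le_mul_exp_of_argmax_rate_le {ν T'' : ℝ} (hν : 0 < ν) (hT'' : 0 < T'')
    {u : ℝ → (EuclideanSpace ℝ (Fin 3)) → (EuclideanSpace ℝ (Fin 3))}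
    {p : ℝ → (EuclideanSpace ℝ (Fin 3)) → ℝ} (hS : IsClassicalNSSolutionOn (Icc 0 T'') ν 0 u p)
    (hB : HasBoundedSobolevNormsOn (Icc 0 T'') u)
    {Φ φ : ℝ → ℝ} (hΦc : ContinuousOn Φ (Icc 0 T''))
    (hΦ : ∀ t ∈ Icc 0 T'', HasDerivWithinAt Φ (φ t) (Icc 0 T'') t)
    (hrate : ∀ t ∈ Icc 0 T'', 0 < t → ∀ x₀ : EuclideanSpace ℝ (Fin 3),
      (∀ x, ‖curl (u t) x‖ ≤ ‖curl (u t) x₀‖) → curl (u t) x₀ ≠ 0 →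
      ⟪vorticityDirection (curl (u t)) x₀, fderiv ℝ (u t) x₀ (vorticityDirection (curl (u t)) x₀)⟫ -
          ν * frobeniusNormSq (fderiv ℝ (vorticityDirection (curl (u t))) x₀) ≤ φ t)
    {M : ℝ} (hM : ∀ x, ‖curl (u 0) x‖ ≤ M) :
    ∀ t ∈ Icc 0 T'', ∀ x, ‖curl (u t) x‖ ≤ M * Real.exp (Φ t - Φ 0) := by
  have hU : UniqueDiffOn ℝ (Icc 0 T'') := uniqueDiffOn_Icc hT''
  have hunif := vorticity_uniform_decay hν hT'' hS hB
  have hωsm : IsSmoothSpaceTimeOn (Icc 0 T'') (vorticity u) :=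
    (hS.smooth_velocity.fderiv_slice hU).clm_comp curlCLM
  have hvort : ∀ t ∈ Icc 0 T'', ∀ x,
      timeDerivWithin (Icc 0 T'') (vorticity u) t x + convect (u t) (vorticity u t) x =
        convect (vorticity u t) (u t) x + ν • (Δ (vorticity u t)) x :=
    fun t ht x =>
    (hS.isVorticitySolutionOn_of_uniqueDiffOn hU (fun s _ y => curl_zero y)).vorticity_eq t ht x
  have hgrow : ∀ t ∈ Icc 0 T'', 0 < t → ∀ x₀ : EuclideanSpace ℝ (Fin 3),
      (∀ x, ‖vorticity u t x‖ ≤ ‖vorticity u t x₀‖) → vorticity u t x₀ ≠ 0 →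
      ⟪vorticity u t x₀, timeDerivWithin (Icc 0 T'') (vorticity u) t x₀⟫ ≤
        φ t * ‖vorticity u t x₀‖ ^ 2 := by
    intro t ht htpos x₀ hmax hne
    have hv : ContDiff ℝ ∞ (u t) := hS.contDiff_velocity ht
    have h1 := inner_vorticity_rhs_le_at_argmax hν.le hv hmax hne (hvort t ht x₀)
    have h2 := hrate t ht htpos x₀ hmax hne
    exact h1.trans (mul_le_mul_of_nonneg_right h2 (sq_nonneg _))
  exact norm_le_mul_exp_of_argmax_inner_timeDeriv_le hωsm hunif hΦc hΦ hgrow hM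


/-- **E1 + threshold comparison on a closed slab (the phase-lemma engine of S35 door B).** In the
S-door frame on `[0,T''] × ℝ³`: let `B > 0` be continuous on `[0,T'']` with one-sided derivative `B'`
and `φ B ≤ B'`; if at every `t ∈ (0,T'']` and every global maximum point `x̄` of `|ω(t,·)|` with
`|ω(t,x̄)| > B(t)` the twist-credited net rate obeys `α(t,x̄) − ν|∇ξ(t,x̄)|²_F ≤ φ(t)`, and
`|ω(0,·)| ≤ B(0)`, then `|ω(t,x)| ≤ B(t)` on the slab. [folklore] -/
theorem norm_curl_le_supersolution_of_argmax_rate_le {ν T'' : ℝ} (hν : 0 < ν) (hT'' : 0 < T'')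
    {u : ℝ → (EuclideanSpace ℝ (Fin 3)) → (EuclideanSpace ℝ (Fin 3))}
    {p : ℝ → (EuclideanSpace ℝ (Fin 3)) → ℝ} (hS : IsClassicalNSSolutionOn (Icc 0 T'') ν 0 u p)
    (hB : HasBoundedSobolevNormsOn (Icc 0 T'') u)
    {B B' φ : ℝ → ℝ} (hBc : ContinuousOn B (Icc 0 T'')) (hBpos : ∀ t ∈ Icc 0 T'', 0 < B t)
    (hBd : ∀ t ∈ Icc 0 T'', HasDerivWithinAt B (B' t) (Icc 0 T'') t)
    (hsuper : ∀ t ∈ Icc 0 T'', φ t * B t ≤ B' t)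
    (hrate : ∀ t ∈ Icc 0 T'', 0 < t → ∀ x₀ : EuclideanSpace ℝ (Fin 3),
      (∀ x, ‖curl (u t) x‖ ≤ ‖curl (u t) x₀‖) → B t < ‖curl (u t) x₀‖ →
      ⟪vorticityDirection (curl (u t)) x₀, fderiv ℝ (u t) x₀ (vorticityDirection (curl (u t)) x₀)⟫ -
          ν * frobeniusNormSq (fderiv ℝ (vorticityDirection (curl (u t))) x₀) ≤ φ t)
    (hM : ∀ x, ‖curl (u 0) x‖ ≤ B 0) :
    ∀ t ∈ Icc 0 T'', ∀ x, ‖curl (u t) x‖ ≤ B t := by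
  have hU : UniqueDiffOn ℝ (Icc 0 T'') := uniqueDiffOn_Icc hT''
  have hunif := vorticity_uniform_decay hν hT'' hS hB
  have hωsm : IsSmoothSpaceTimeOn (Icc 0 T'') (vorticity u) :=
    (hS.smooth_velocity.fderiv_slice hU).clm_comp curlCLM
  have hvort : ∀ t ∈ Icc 0 T'', ∀ x,
      timeDerivWithin (Icc 0 T'') (vorticity u) t x + convect (u t) (vorticity u t) x =
        convect (vorticity u t) (u t) x + ν • (Δ (vorticity u t)) x :=
    fun t ht x =>
    (hS.isVorticitySolutionOn_of_uniqueDiffOn hU (fun s _ y => curl_zero y)).vorticity_eq t ht x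
  have hgrow : ∀ t ∈ Icc 0 T'', 0 < t → ∀ x₀ : EuclideanSpace ℝ (Fin 3),
      (∀ x, ‖vorticity u t x‖ ≤ ‖vorticity u t x₀‖) → B t < ‖vorticity u t x₀‖ →
      ⟪vorticity u t x₀, timeDerivWithin (Icc 0 T'') (vorticity u) t x₀⟫ ≤
        φ t * ‖vorticity u t x₀‖ ^ 2 := by
    intro t ht htpos x₀ hmax hbig
    have hv : ContDiff ℝ ∞ (u t) := hS.contDiff_velocity ht
    have hne : vorticity u t x₀ ≠ 0 := by
      intro h0
      have : ‖vorticity u t x₀‖ = 0 := by rw [h0, norm_zero]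
      linarith [hBpos t ht]
    have h1 := inner_vorticity_rhs_le_at_argmax hν.le hv hmax hne (hvort t ht x₀)
    have h2 := hrate t ht htpos x₀ hmax hbig
    exact h1.trans (mul_le_mul_of_nonneg_right h2 (sq_nonneg _))
  exact norm_le_supersolution_of_argmax_growth hωsm hunif hBc hBpos hBd hsuper hgrow hM

end Engine

end Summit.NavierStokesRegularity.NavierStokesRegularity.Theorems.ArgmaxDoors

end
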